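import Literature.Order.WellQuasiOrder.UpperSets
import Mathlib.RingTheory.MvPolynomial.Ideal
import Mathlib.Order.Preorder.Finsupp
import Mathlib.Data.Finsupp.Order
import Mathlib.Order.UpperLower.Closure
import HarnessLib

/-!
# Antichains of monomial ideals are finite (Maclagan 2001, Thm. 1.1)

Topic: `Literature/Order/WellQuasiOrder`. The printed form of Maclagan's theorem: **Theorem 1.1.**
"Let `𝓘` be an infinite collection of monomial ideals in a polynomial ring. Then there are two
ideals `I, J ∈ 𝓘` with `I ⊆ J`" (`I ≠ J` being understood: "a proper inclusion", loc. cit.,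
proof of Cor. 2.1) — deduced, as in the paper ("monomial ideals are highly combinatorial
objects … the above theorem can be restated as follows: Theorem 1.2"), from the statement for
upper sets of `ℕⁿ` (`UpperSets.lean`) through the dictionary

  monomial ideal `⟨x^a : a ∈ s⟩`  ↦  upper closure of `s` in `ℕⁿ`,

which is an order embedding for inclusion (`monomialIdeal_le_iff`, from Mathlib's
`MvPolynomial.mem_ideal_span_monomial_image`). Here a *monomial ideal* of `R[X_1, …, X_n]`
(`R` a nontrivial commutative ring, e.g. a field) is an ideal of the form
`monomialIdeal s = Ideal.span {X^a | a ∈ s}` for a set `s` of exponent vectors.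

* `wellQuasiOrderedLE_upperSet_finsupp` — `UpperSet (Fin n →₀ ℕ)` is well-quasi-ordered
  (transport of `wellQuasiOrderedLE_upperSet_finNat` along Mathlib's
  `Finsupp.orderIsoFunOnFinite : (Fin n →₀ ℕ) ≃o (Fin n → ℕ)`; no order isomorphism is
  redefined here — `lean search orderIsoFunOnFinite`).
* `monomialIdeal` (no Mathlib namesake; it is the span appearing in
  `MvPolynomial.mem_ideal_span_monomial_image`), `monomialIdeal_le_iff`,
  `upperClosure_eq_of_monomialIdeal_eq`.
* `Maclagan.exists_ne_le_of_infinite_monomialIdeals` — **Thm. 1.1**: an infinite set of monomial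
  ideals contains `I ≠ J` with `I ≤ J`; `Maclagan.exists_lt_monomialIdeal_le` — sequence form:
  in any sequence of monomial ideals `I₀, I₁, …` there are `i < j` with `I_j ≤ I_i` (the
  well-quasi-order of upper sets by reverse inclusion gives `U_j ⊆ U_i` for the exponent sets).

## Sources

* D. Maclagan, Proc. Amer. Math. Soc. 129 (2001) 1609–1615 = arXiv:math/9909168, Thm. 1.1.
  [Maclagan2001]
-/

noncomputable section

namespace Literature.Order.WellQuasiOrder

open MvPolynomial

/-! ## Exponent vectors: `Fin n →₀ ℕ` versus `Fin n → ℕ` -/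

/-- **The upper sets of `Fin n →₀ ℕ` (exponent vectors) are well-quasi-ordered by reverse
inclusion** — transport of `wellQuasiOrderedLE_upperSet_finNat` along Mathlib's order
isomorphism `Finsupp.orderIsoFunOnFinite : (ι →₀ ℕ) ≃o (ι → ℕ)` (as Mathlib's own
`Finsupp.isPWO` does for Dickson's lemma). [cite: Maclagan2001, Thm. 1.2] -/
theorem wellQuasiOrderedLE_upperSet_finsupp (n : ℕ) : WellQuasiOrderedLE (UpperSet (Fin n →₀ ℕ)) :=
  haveI := wellQuasiOrderedLE_upperSet_finNat n
  (UpperSet.map (Finsupp.orderIsoFunOnFinite (ι := Fin n) (M := ℕ))).wellQuasiOrderedLE_iff.mpr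
    inferInstance

/-! ## Monomial ideals -/

section Monomial

variable {σ : Type*} (R : Type*) [CommRing R]

/-- The **monomial ideal** `⟨X^a : a ∈ s⟩ ⊆ R[X_i : i ∈ σ]` generated by the monomials with
exponents in `s`. [cite: Maclagan2001, §1] -/
def monomialIdeal (s : Set (σ →₀ ℕ)) : Ideal (MvPolynomial σ R) :=
  Ideal.span ((fun a => monomial a (1 : R)) '' s)

variable {R}

/-- A monomial `X^a` lies in `⟨X^b : b ∈ t⟩` iff `b ≤ a` for some `b ∈ t` (over a nontrivial
ring). [folklore] -/
theorem monomial_mem_monomialIdeal_iff [Nontrivial R] {t : Set (σ →₀ ℕ)} {a : σ →₀ ℕ} :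
    monomial a (1 : R) ∈ monomialIdeal R t ↔ ∃ b ∈ t, b ≤ a := by
  classical
  rw [monomialIdeal, mem_ideal_span_monomial_image, support_monomial, if_neg one_ne_zero]
  simp

/-- **Inclusion of monomial ideals is domination of exponent sets**:
`⟨X^a : a ∈ s⟩ ≤ ⟨X^b : b ∈ t⟩` iff every `a ∈ s` lies above some `b ∈ t`, iff
`upperClosure t ≤ upperClosure s` in `UpperSet` (reverse inclusion: `↑s ⊆ ↑t`).
[cite: Maclagan2001, §1] -/
theorem monomialIdeal_le_iff [Nontrivial R] {s t : Set (σ →₀ ℕ)} :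
    monomialIdeal R s ≤ monomialIdeal R t ↔ upperClosure t ≤ upperClosure s := by
  constructor
  · intro h x hx
    -- `hx : x ∈ upperClosure s`, goal `x ∈ upperClosure t`
    obtain ⟨a, ha, hax⟩ := mem_upperClosure.mp hx
    have : monomial a (1 : R) ∈ monomialIdeal R t :=
      h (Ideal.subset_span ⟨a, ha, rfl⟩)
    obtain ⟨b, hb, hba⟩ := monomial_mem_monomialIdeal_iff.mp this
    exact mem_upperClosure.mpr ⟨b, hb, hba.trans hax⟩
  · intro h
    refine Ideal.span_le.mpr ?_
    rintro _ ⟨a, ha, rfl⟩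
    have hx : a ∈ upperClosure t := h (subset_upperClosure ha)
    obtain ⟨b, hb, hba⟩ := mem_upperClosure.mp hx
    exact monomial_mem_monomialIdeal_iff.mpr ⟨b, hb, hba⟩

/-- Monomial ideals with the same ideal have the same upper closure of exponents. [folklore] -/
theorem upperClosure_eq_of_monomialIdeal_eq [Nontrivial R] {s t : Set (σ →₀ ℕ)}
    (h : monomialIdeal R s = monomialIdeal R t) : upperClosure s = upperClosure t :=
  le_antisymm (monomialIdeal_le_iff.mp h.ge) (monomialIdeal_le_iff.mp h.le)

end Monomial

namespace Maclagan

variable {n : ℕ} {R : Type*} [CommRing R] [Nontrivial R]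

/-- **Maclagan 2001, Thm. 1.1**: "Let `𝓘` be an infinite collection of monomial ideals in a
polynomial ring. Then there are two ideals `I, J ∈ 𝓘` with `I ⊆ J`" (and `I ≠ J`).
[cite: Maclagan2001, Thm. 1.1] -/
theorem exists_ne_le_of_infinite_monomialIdeals {𝓘 : Set (Ideal (MvPolynomial (Fin n) R))}
    (hmon : ∀ I ∈ 𝓘, ∃ s : Set (Fin n →₀ ℕ), I = monomialIdeal R s) (hinf : 𝓘.Infinite) :
    ∃ I ∈ 𝓘, ∃ J ∈ 𝓘, I ≠ J ∧ I ≤ J := by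
  choose! gen hgen using hmon
  -- an injective sequence of members of `𝓘`
  let e : ℕ ↪ 𝓘 := hinf.natEmbedding 𝓘
  -- Maclagan for the upper closures of the generating exponent sets
  obtain ⟨i, j, hij, hle⟩ :=
    (wellQuasiOrderedLE_upperSet_finsupp n).wqo fun k => upperClosure (gen (e k).1)
  -- `hle : ↑gen(e j) ⊆ ↑gen(e i)`, i.e. `e j ≤ e i` as monomial ideals
  refine ⟨(e j).1, (e j).2, (e i).1, (e i).2, fun h => ?_, ?_⟩
  · exact absurd (e.injective (Subtype.ext h)) (Nat.ne_of_lt hij).symm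
  · rw [hgen _ (e j).2, hgen _ (e i).2]
    exact monomialIdeal_le_iff.mpr hle

/-- **Maclagan, sequence form for monomial ideals**: in any sequence `I₀, I₁, …` of monomial
ideals of `R[X_1, …, X_n]` there are `i < j` with `I_j ≤ I_i`. [cite: Maclagan2001, Thm. 1.1] -/
theorem exists_lt_monomialIdeal_le (s : ℕ → Set (Fin n →₀ ℕ)) :
    ∃ i j, i < j ∧ monomialIdeal R (s j) ≤ monomialIdeal R (s i) := by
  obtain ⟨i, j, hij, hle⟩ :=
    (wellQuasiOrderedLE_upperSet_finsupp n).wqo fun k => upperClosure (s k)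
  exact ⟨i, j, hij, monomialIdeal_le_iff.mpr hle⟩

end Maclagan

end Literature.Order.WellQuasiOrder

end
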